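import Mathlib
import Literature.MathematicalPhysics.QuantumFieldTheory.Balaban1983to89.B12Decay510Window

/-!
# `Balaban1983to89.B12Decay510R1` — T. Bałaban, *Renormalization group approach to lattice gauge field theories. I.
Generation of effective actions in a small field approximation and a coupling constant renormalization in four
dimensions*, Commun. Math. Phys. **109**, 249–301 (1987) [Balaban1987RG1]: **the `r = 1` term of (4.3) at `n = 2`**
(p. 281 [PDF 33]) — absent from (4.35) (p. 290 [42]) *"by the identity (4.14)"* (p. 284 [36]) — **and (5.10) (p. 293
[45]) with and without it** (PDF page = journal page − 248; PDF held: `paper:balaban1987-cmp109-rg-i-small-field`).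

CITATION HEADER (lean-in-tree rule 2026-08-18).  Satellite of `…Balaban1983to89.B12Decay510` (the derivation of (5.10)
modulo named printed leaves, unit `b2b-balaban-b03-g3`; cell GAPS C-b03g3-1 / G-b03g3-1) and of `…B12Decay510Window`
(its window model; imports that module only, modifies nothing).  Unit `b2b-balaban-b03-g4`
(paper sub-cell B03 gen 4), answering cell GAPS G-b03g3-1 (2)(f): *"the r = 1 term of (4.3) at n = 2,
⟨δ𝐄(X,1)/δ𝐇, δ²𝐇_j(□₀,0)/δB²⟩, is ABSENT from (4.35) as printed — it vanishes iff δ𝐄(X, 1)/δ𝐇 = 0 … and otherwise is one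
more term of the same Cauchy type covered by (4.5) with n(p) = 2 …; not modelled (`hrepr` takes (4.35) as printed)"*.
Quotations re-read on the 300-dpi renders `HOME/b2b-balaban-ref1/pages/1987-cmp109-rg-I-small-field/…-p033-x2.png`
(p. 281), `…-p034-x2.png` (p. 282), `…-p036-x2.png` (p. 284), `…-p042-x2.png` (p. 290).

WHAT THE PAPER PRINTS (and nothing else is attributed to it):
* p. 281 [33] (4.3), first and second members, verbatim: *"Differentiating the composite function on the right-hand
  side above n times with respect to B, we obtain the identities ⟨δⁿ/δBⁿ 𝐄^{(j)}(X, U_j(□₀, 1)), ⊗_{i=1}^n B_i⟩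
  = Σ_{{1,…,n}=N(1)∪…∪N(r)} ⟨δʳ/δ𝐇ʳ 𝐄^{(j)}(X, 1), ⊗_{p=1}^r ⟨δ^{n(p)}/δB^{n(p)} 𝐇_j(□₀, 0), ⊗_{i∈N(p)} B_i⟩⟩
  = Σ ∂ʳ/(∂τ₁…∂τ_r) 𝐄^{(j)}(X, exp iξ Σ_{p=1}^r τ_p ⟨δ^{n(p)}/δB^{n(p)} 𝐇_j(□₀, 0), ⊗_{i∈N(p)} B_i⟩)∣_{τ=0} = …"* —
  for n = 2 the set partitions of {1, 2} are {1}{2} (r = 2) and {1, 2} (r = 1, n(1) = 2): TWO terms, the second being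
  ∂/∂τ 𝐄^{(j)}(X, exp iξ τ⟨δ²𝐇_j(□₀, 0)/δB², B₁ ⊗ B₂⟩)∣_{τ=0} (the identity itself is kernel-checked in the tree:
  `B12Repr43.faaDiBruno_apply`, unit pv12).
* p. 282 [34], verbatim: *"The functional derivative (δ^{n(p)})/(δB^{n(p)})𝐇_j(□₀, 0) is given by a sum of several
  perturbative expressions discussed in Sect. G [15]. Each expression corresponds to a tree graph with n(p) initial
  points and one final point, and it has an exponential decay in a length of this graph. The derivative has an
  exponential decay in a length of a shortest tree graph of this type. The norm in (4.4) of the expression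
  ⟨(δ^{n(p)}/δB^{n(p)})𝐇_j(□₀, 0), ⊗_{i∈N(p)}B_i⟩ can be estimated by B₃Π_{i∈N(p)}∣B_i∣, and if one of the functions B_i
  is localized outside the domain X, then we have the additional exponential factor exp(−δ₀dist^{(ξ)}(X, supp B_i))."*
* p. 282 [34], verbatim: *"Take a function 𝐄(V) defined and analytic on a domain of small gauge field configurations V
  on a unit lattice, and assume that it is gauge invariant, i.e., 𝐄(V^v) = 𝐄(V), V^v(b) = v(b₋)V(b)v⁻¹(b₊). (4.7)"*, and
  p. 284 [36], verbatim: *"For constant λ we get ⟨(δ/δB)𝐄(1), iad_λB₁⟩ = 0, and since the configuration B₁ is arbitrary,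
  we get [λ, (δ/δB)𝐄(1)] = 0 for all λ ∈ 𝐠ᶜ. The group G is semisimple, hence this is possible only for the element 0 in
  the algebra 𝐠ᶜ. Thus we have the first, very important consequence of the gauge invariance (δ/δB)𝐄(1) = 0. (4.14)
  This equality simplifies the identities, and also the sum (4.6), we can drop the term with n = 1."*
* p. 281 [33], verbatim: *"Using the gauge transformation in (3.37), and the gauge invariance of the function 𝐄^{(j)}(X,
  U), we have 𝐄^{(j)}(X, U_j(□₀, exp iB)) = 𝐄^{(j)}(X, exp iξ𝐇_j(□₀, B)). (4.2)"*
* p. 290 [42], verbatim: *"At first we have to change the function U_j(□₀) used in the definitions of 𝐄^{(n)}(X). For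
  n = 2, and by the identity (4.14), the formula (4.3) yields 𝐄^{(2)}(X) = ⟨(δ²/δ𝐇²)𝐄(X, 1), H_j(□₀), H_j(□₀)⟩. (4.35)"*
* p. 293 [45] (5.10) and its leaves: see the header of `…Balaban1983to89.B12Decay510`.

WHAT THIS MODULE PROVES (kernel-checked; every input a NAMED hypothesis, nothing asserted).
(1) `firstDeriv`, `firstDeriv_eq_fderiv`, `norm_firstDeriv_le` — the r = 1 member of (4.3), ∂/∂τ E(τv)∣_{τ=0} for a
    function E of the complex configuration ((4.4)-space `W`), = DE(0)v, and its Cauchy estimate: E analytic on the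
    ball ‖𝐀‖ < α with ∣E∣ ≤ S there ⇒ ∣∂_τE(τv)∣₀∣ ≤ Sα⁻¹‖v‖ (one circle ∣τ∣ = ρ/‖v‖, ρ ↑ α; Mathlib
    `Complex.norm_deriv_le_of_forall_mem_sphere_norm_le`) — the n = 1 instance of the arithmetic of (4.5).
(2) `kernelBound_r1`, `kernelBound_of_repr43`, `abs_twoPoint_le_of_repr43`, `decay510_of_repr43_leaves` — (5.10) IS
    ROBUST TO THE r = 1 TERM: with the FULL n = 2 form of (4.3), 𝐄^{(2)}(X, x, y) = Re ∂²_{τ₁τ₂}E_X(τ₁h_X(x) + τ₂h_X(y))∣₀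
    + Re ∂_τE_X(τ h⁽²⁾_X(x, y))∣₀ (`hrepr`), where h⁽²⁾_X(x, y) = the (4.4)-space image of ⟨δ²𝐇_j(□₀,0)/δB², δ_x ⊗ δ_y⟩,
    and the p. 282 bound for the block n(p) = 2 in its two-factor form ‖h⁽²⁾_X(x, y)‖ ≤ B₃′e^{−δ₀dist(x,X)}e^{−δ₀dist(y,X)}
    (`hh2`: *"the additional exponential factor"* for EACH B_i localized outside X), the two-sided kernel bound holds
    with C_E = 4E₀α₂⁻²B₃² + E₀α₂⁻¹B₃′, hence (5.10) with THE SAME printed δ₁ = ½ min{δ₀, κM⁻¹} and the constant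
    (4E₀α₂⁻²B₃² + E₀α₂⁻¹B₃′)e^{δ₁Mc₁}K₀K₁ — landing in `B12Sec2to5.Decay510` for a volume-uniform family exactly as
    `B12Decay510.decay510_of_analytic_leaves`.
(3) `twoFactor_of_treeDecay` — the two-factor form at rate δ₀/2 FROM the printed tree-graph decay: if
    ‖h⁽²⁾_X(x, y)‖ ≤ B e^{−δ₀ℓ} with ℓ = the length of a (shortest) tree graph with initial points x, y and final point in
    X, then — a tree through x, y and a point of X being at least dist(x, X) and at least dist(y, X) long (`hℓx`, `hℓy`) —
    ‖h⁽²⁾_X(x, y)‖ ≤ B e^{−(δ₀/2)dist(x,X)} e^{−(δ₀/2)dist(y,X)}.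
(4) `firstDeriv_eq_zero_of_fderiv_eq_zero`, `repr435_of_repr43`, `abs_twoPoint_le_of_repr43_of_414` — THE VANISHING
    MECHANISM: IF the derivative of 𝐀 ↦ 𝐄^{(j)}(X, exp iξ𝐀) at 𝐀 = 0 vanishes (`h414 : fderiv ℂ (EX X) 0 = 0` — (4.14)
    applied to the gauge-invariant analytic function 𝐄^{(j)}(X, ·) of (4.2), the "𝐇-form"), THEN the r = 1 term is 0 in
    EVERY direction, the full form (2) reduces to (4.35) as printed, and (5.10) holds with the constant of
    `B12Decay510.abs_twoPoint_le_of_analytic`.  The "B-form" — (4.14) applied to V ↦ 𝐄^{(j)}(X, U_j(□₀, V)) on the unit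
    lattice, i.e. by (4.3) at n = 1 the vanishing of ∂_τE_X(τ h_X(x))∣₀ on the directions h_X(x) = images of
    δ𝐇_j(□₀,0)/δB — follows from the 𝐇-form (`bForm_of_hForm`) but does not by itself annihilate the direction
    h⁽²⁾_X(x, y); the kernel uses the 𝐇-form, and (2) shows nothing in (5.10) depends on the choice.
(5) `eq_zero_of_forall_lie_eq_zero` — the algebra of the step (4.13) ⇒ (4.14): in a semisimple Lie algebra (Mathlib
    `LieAlgebra.IsSemisimple`, centre = ⊥) an element commuting with everything is 0 (*"[λ, (δ/δB)𝐄(1)] = 0 for all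
    λ ∈ 𝐠ᶜ … possible only for the element 0"*), pointwise for a 𝐠-valued function.
(6) `decay510_window_r1` — (2) in the window model of `B12Decay510Window.decay510_window` (exhausting windows of ℤᵈ,
    every geometric leaf discharged there): `Decay510 P ((4E₀α₂⁻²B₃² + E₀α₂⁻¹B₃′) e^{2dδ₁} K₀(4·2ᵈ,2d) K₁(δ₀/2)) δ₁`,
    δ₁ = ½ min{δ₀, κ/d} — same rate as `decay510_window`, O(1) enlarged by E₀α₂⁻¹B₃′.
RESIDUAL LEAVES (named hypotheses, located in print, not proved here): those of `B12Decay510` ((4.4)-analyticity with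
(1.18), the decay `hh` — discharged from (190) in the sibling `B12Decay510FromB11` —, geometry, cube-sum, domain-sum
leaves, the limit (5.1)); the n(p) = 2 block bound `hh2` (p. 282 by reference to [15] Sect. G tree graphs — NOT typed in
the tree, cell GAPS G-B11-G2a); the 𝐇-form of (4.14) for 𝐄^{(j)}(X, ·) (gauge invariance (4.2) + (4.8)–(4.13) + (5)).
DIVERGENCES (cell DIVERGENCE.md D-b03.13): the kernel E2 is typed as the real part of the sum of the two τ-derivative
members of (4.3) at n = 2 on abstract directions h_X(x), h⁽²⁾_X(x, y) ∈ W (the identification of ⟨δ^{n(p)}𝐇_j/δB^{n(p)},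
⊗B_i⟩ restricted to X with elements of one complex normed space per system, as in `B12Decay510` D-b03.7–9); the p. 282
decay for n(p) = 2 is typed in the two-factor form (one factor per B_i, the literal sentence) and derived at half rate
from the tree-length form (3); (4.14) is typed as the vanishing of a Fréchet derivative at 0, its two readings kept
apart.  Value = kernel-checked robustness of a located printed step to an unprinted simplification, NOT summit
progress.
-/

namespace Literature.MathematicalPhysics.QuantumFieldTheory.Balaban1983to89.B12Decay510R1

open Literature.MathematicalPhysics.QuantumFieldTheory.Balaban1983to89
open Literature.MathematicalPhysics.QuantumFieldTheory.Balaban1983to89.B12Decay510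
open Filter Topology Metric

/-! ## 1. The r = 1 member of (4.3) and its Cauchy estimate -/

section Cauchy

variable {W : Type*} [NormedAddCommGroup W] [NormedSpace ℂ W]

/-- p. 281 [33] (4.3), second member at r = 1: ∂/∂τ E(τv)∣_{τ=0} for a function E of the configuration 𝐀 ∈ W along the
direction v — at n = 2 the direction is v = ⟨δ²𝐇_j(□₀, 0)/δB², B₁ ⊗ B₂⟩ (block N(1) = {1, 2}).
[cite: Balaban1987RG1, (4.3) p.281] -/
noncomputable def firstDeriv (E : W → ℂ) (v : W) : ℂ :=
  deriv (fun τ : ℂ => E (τ • v)) 0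

/-- The first member of (4.3) at r = 1: ∂/∂τ E(τv)∣₀ = DE(0)v at a point of differentiability (chain rule,
`B12Decay510.deriv_line`). [cite: Balaban1987RG1, (4.3) p.281] -/
theorem firstDeriv_eq_fderiv (E : W → ℂ) (v : W) (hd : DifferentiableAt ℂ E 0) :
    firstDeriv E v = fderiv ℂ E 0 v := by
  have h := deriv_line E v 0 hd
  simp only [add_zero] at h
  exact h

/-- Along the zero direction the r = 1 member vanishes. [folklore] -/
@[simp] theorem firstDeriv_zero (E : W → ℂ) : firstDeriv E 0 = 0 := by
  simp [firstDeriv]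

/-- **The Cauchy estimate of the r = 1 member on a closed sub-ball**: E analytic on ‖𝐀‖ < α ((4.4)) and ∣E∣ ≤ S on the
closed ball of radius ρ < α ((1.18)) ⇒ ∣∂_τE(τv)∣₀∣ ≤ Sρ⁻¹‖v‖ — the third member of (4.3) *"(1/2πi)∮ dτ/τ² 𝐄^{(j)}(…)"*
on the circle ∣τ∣ = ρ/‖v‖ (Mathlib `Complex.norm_deriv_le_of_forall_mem_sphere_norm_le`).
[cite: Balaban1987RG1, (4.3)-(4.5) pp.281-282] -/
theorem norm_firstDeriv_le_of_closedBall {E : W → ℂ} {α ρ S : ℝ}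
    (hE : AnalyticOnNhd ℂ E (ball 0 α)) (hρ : 0 < ρ) (hρα : ρ < α)
    (hS : ∀ v ∈ closedBall (0 : W) ρ, ‖E v‖ ≤ S) (v : W) :
    ‖firstDeriv E v‖ ≤ S / ρ * ‖v‖ := by
  have hS0 : 0 ≤ S := (norm_nonneg _).trans (hS 0 (mem_closedBall_self hρ.le))
  have hball : closedBall (0 : W) ρ ⊆ ball 0 α := closedBall_subset_ball hρα
  have hdiffE : ∀ w ∈ closedBall (0 : W) ρ, DifferentiableAt ℂ E w :=
    fun w hw => (hE w (hball hw)).differentiableAt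
  by_cases hv : v = 0
  · subst hv
    rw [firstDeriv_zero, norm_zero]
    positivity
  have hv' : 0 < ‖v‖ := norm_pos_iff.2 hv
  set r : ℝ := ρ / ‖v‖ with hr
  have hr0 : 0 < r := div_pos hρ hv'
  have hin : ∀ τ : ℂ, ‖τ‖ ≤ r → τ • v ∈ closedBall (0 : W) ρ := by
    intro τ h1
    rw [mem_closedBall, dist_zero_right, norm_smul]
    calc ‖τ‖ * ‖v‖ ≤ r * ‖v‖ := by gcongr
      _ = ρ := by rw [hr]; exact div_mul_cancel₀ ρ hv'.ne'
  have key : ‖firstDeriv E v‖ ≤ S / r := by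
    unfold firstDeriv
    refine Complex.norm_deriv_le_of_forall_mem_sphere_norm_le hr0 ?_ ?_
    · refine DifferentiableOn.diffContOnCl ?_
      rw [closure_ball (0 : ℂ) hr0.ne']
      intro τ h1
      rw [mem_closedBall, dist_zero_right] at h1
      have hd := hdiffE _ (hin τ h1)
      have hlin : DifferentiableAt ℂ (fun τ : ℂ => τ • v) τ := differentiableAt_id.smul_const v
      exact (hd.comp τ hlin).differentiableWithinAt
    · intro τ h1
      rw [mem_sphere, dist_zero_right] at h1
      exact hS _ (hin τ h1.le)
  calc ‖firstDeriv E v‖ ≤ S / r := key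
    _ = S / ρ * ‖v‖ := by rw [hr, div_div_eq_mul_div]; ring

/-- **The Cauchy estimate of the r = 1 member, radius α itself**: E analytic on ‖𝐀‖ < α with ∣E∣ ≤ S there ⇒
∣∂_τE(τv)∣₀∣ ≤ Sα⁻¹‖v‖ (ρ ↑ α in the closed-sub-ball bound) — the n = 1 instance of the arithmetic of (4.5).
[cite: Balaban1987RG1, (4.5) p.282] -/
theorem norm_firstDeriv_le {E : W → ℂ} {α S : ℝ} (hα : 0 < α)
    (hE : AnalyticOnNhd ℂ E (ball 0 α)) (hS : ∀ v ∈ ball (0 : W) α, ‖E v‖ ≤ S) (v : W) :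
    ‖firstDeriv E v‖ ≤ S / α * ‖v‖ := by
  have key : ∀ ρ, 0 < ρ → ρ < α → ‖firstDeriv E v‖ ≤ S / ρ * ‖v‖ :=
    fun ρ h1 h2 => norm_firstDeriv_le_of_closedBall hE h1 h2
      (fun w hw => hS w (closedBall_subset_ball h2 hw)) v
  have hc : ContinuousAt (fun ρ : ℝ => S / ρ * ‖v‖) α :=
    (continuousAt_const.div continuousAt_id hα.ne').mul continuousAt_const
  have ht : Tendsto (fun ρ : ℝ => S / ρ * ‖v‖) (𝓝[<] α) (𝓝 (S / α * ‖v‖)) :=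
    hc.tendsto.mono_left nhdsWithin_le_nhds
  refine ge_of_tendsto ht ?_
  have h1 : ∀ᶠ ρ in 𝓝[<] α, ρ ∈ Set.Iio α := eventually_mem_nhdsWithin
  have h2 : ∀ᶠ ρ in 𝓝[<] α, 0 < ρ := (eventually_gt_nhds hα).filter_mono nhdsWithin_le_nhds
  filter_upwards [h1, h2] with ρ hρα hρ using key ρ hρ hρα

/-- **(4.14), 𝐇-form ⇒ the r = 1 member vanishes in every direction**: if the Fréchet derivative of E at 𝐀 = 0 is 0
(*"(δ/δB)𝐄(1) = 0. (4.14)"* for the gauge-invariant analytic function 𝐄 = 𝐄^{(j)}(X, ·) of (4.2)), then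
∂_τE(τv)∣₀ = 0 for all v — in particular for v = ⟨δ²𝐇_j(□₀,0)/δB², B₁ ⊗ B₂⟩, which is how (4.35) drops the r = 1 term.
[cite: Balaban1987RG1, (4.14) p.284 and (4.35) p.290] -/
theorem firstDeriv_eq_zero_of_fderiv_eq_zero {E : W → ℂ} (hd : DifferentiableAt ℂ E 0)
    (h414 : fderiv ℂ E 0 = 0) (v : W) : firstDeriv E v = 0 := by
  rw [firstDeriv_eq_fderiv E v hd, h414, zero_apply]

/-- **𝐇-form ⇒ B-form of (4.14)**: the vanishing of the derivative of 𝐄^{(j)}(X, ·) at 0 (𝐇-form) implies the vanishing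
of ∂_τ𝐄^{(j)}(X, U_j(□₀, exp iτB))∣₀ = ∂_τE_X(τ·h(B))∣₀ for every B ((4.2) + (4.3) at n = 1, h(B) = the image of
δ𝐇_j(□₀,0)/δB·B), i.e. (4.14) for the unit-lattice function V ↦ 𝐄^{(j)}(X, U_j(□₀, V)); the converse direction is not
claimed (the B-form constrains the derivative only on the range of δ𝐇_j(□₀,0)/δB). [cite: Balaban1987RG1, (4.14) p.284] -/
theorem bForm_of_hForm {E : W → ℂ} (hd : DifferentiableAt ℂ E 0) (h414 : fderiv ℂ E 0 = 0) {FB : Type*}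
    (h : FB → W) : ∀ B : FB, firstDeriv E (h B) = 0 :=
  fun B => firstDeriv_eq_zero_of_fderiv_eq_zero hd h414 (h B)

end Cauchy

/-! ## 2. (4.13) ⇒ (4.14): the semisimplicity step -/

/-- **(4.13) ⇒ (4.14), the algebra**: p. 284 [36] *"we get [λ, (δ/δB)𝐄(1)] = 0 for all λ ∈ 𝐠ᶜ. The group G is
semisimple, hence this is possible only for the element 0 in the algebra 𝐠ᶜ"* — in a semisimple Lie algebra the centre
is trivial (Mathlib: `LieAlgebra.IsSemisimple` ⇒ `LieAlgebra.center_eq_bot`), so a 𝐠-valued function z on the bonds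
with [λ, z(b)] = 0 for all λ, b is 0. [cite: Balaban1987RG1, (4.13)-(4.14) p.284] -/
theorem eq_zero_of_forall_lie_eq_zero {R L : Type*} [CommRing R] [LieRing L] [LieAlgebra R L]
    [LieAlgebra.IsSemisimple R L] {β : Type*} (z : β → L) (h : ∀ (l : L) (b : β), ⁅l, z b⁆ = 0) : z = 0 := by
  funext b
  have hz : z b ∈ LieAlgebra.center R L := (LieModule.mem_maxTrivSubmodule R L L (z b)).mpr fun l => h l b
  rw [LieAlgebra.center_eq_bot R L] at hz
  simpa using hz

/-! ## 3. (5.10) with the full n = 2 form of (4.3): robustness to the r = 1 term -/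

section Robust

variable {S : LocDomainSys} {C : B12.CubeCover S} {Λ : Type*}
variable {W : Type*} [NormedAddCommGroup W] [NormedSpace ℂ W]

/-- Two-sided kernel bounds add: `KernelBound` for T₁ with C₁ and for T₂ with C₂ (same rates) ⇒ for T₁ + T₂ with
C₁ + C₂. [folklore] -/
theorem kernelBound_add (G : SiteGeometry C Λ) {T₁ T₂ : S.Dom → Λ → Λ → ℝ} {C₁ C₂ κ δ₀ : ℝ}
    (h₁ : KernelBound G T₁ C₁ κ δ₀) (h₂ : KernelBound G T₂ C₂ κ δ₀) :
    KernelBound G (fun X x y => T₁ X x y + T₂ X x y) (C₁ + C₂) κ δ₀ := by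
  intro X x y
  have e1 := h₁ X x y
  have e2 := h₂ X x y
  calc |T₁ X x y + T₂ X x y| ≤ |T₁ X x y| + |T₂ X x y| := abs_add_le _ _
    _ ≤ C₁ * Real.exp (-κ * S.dj X) * Real.exp (-δ₀ * G.distD x X) * Real.exp (-δ₀ * G.distD y X) +
          C₂ * Real.exp (-κ * S.dj X) * Real.exp (-δ₀ * G.distD x X) * Real.exp (-δ₀ * G.distD y X) :=
        add_le_add e1 e2
    _ = (C₁ + C₂) * Real.exp (-κ * S.dj X) * Real.exp (-δ₀ * G.distD x X) * Real.exp (-δ₀ * G.distD y X) := by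
        ring

/-- **The r = 1 term obeys the two-sided kernel bound**: for E_X analytic on the (4.4)-ball of radius α₂ and bounded by
E₀e^{−κd_j(X)} there ((1.18)), and the n(p) = 2 block direction bounded in the two-factor form of p. 282,
‖h⁽²⁾_X(x, y)‖ ≤ B₃′e^{−δ₀dist(x,X)}e^{−δ₀dist(y,X)} (*"the additional exponential factor"* for each B_i = δ_x, δ_y
localized outside X), the term Re ∂_τE_X(τh⁽²⁾_X(x, y))∣₀ satisfies `KernelBound` with C_E = E₀α₂⁻¹B₃′ (the Cauchy
estimate `norm_firstDeriv_le`). [cite: Balaban1987RG1, (4.3)-(4.5) pp.281-282] -/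
theorem kernelBound_r1 (G : SiteGeometry C Λ) (EX : S.Dom → W → ℂ) (h2 : S.Dom → Λ → Λ → W)
    {α₂ E₀ κ B₃' δ₀ : ℝ} (hα₂ : 0 < α₂) (han : ∀ X, AnalyticOnNhd ℂ (EX X) (ball 0 α₂))
    (h118 : ∀ X, ∀ v ∈ ball (0 : W) α₂, ‖EX X v‖ ≤ E₀ * Real.exp (-κ * S.dj X))
    (hh2 : ∀ X x y, ‖h2 X x y‖ ≤ B₃' * Real.exp (-δ₀ * G.distD x X) * Real.exp (-δ₀ * G.distD y X)) :
    KernelBound G (fun X x y => (firstDeriv (EX X) (h2 X x y)).re) (E₀ / α₂ * B₃') κ δ₀ := by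
  intro X x y
  have hS0 : 0 ≤ E₀ * Real.exp (-κ * S.dj X) := (norm_nonneg _).trans (h118 X 0 (mem_ball_self hα₂))
  show |(firstDeriv (EX X) (h2 X x y)).re| ≤ _
  calc |(firstDeriv (EX X) (h2 X x y)).re| ≤ ‖firstDeriv (EX X) (h2 X x y)‖ := Complex.abs_re_le_norm _
    _ ≤ E₀ * Real.exp (-κ * S.dj X) / α₂ * ‖h2 X x y‖ := norm_firstDeriv_le hα₂ (han X) (h118 X) _
    _ ≤ E₀ * Real.exp (-κ * S.dj X) / α₂ *
          (B₃' * Real.exp (-δ₀ * G.distD x X) * Real.exp (-δ₀ * G.distD y X)) :=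
        mul_le_mul_of_nonneg_left (hh2 X x y) (div_nonneg hS0 hα₂.le)
    _ = E₀ / α₂ * B₃' * Real.exp (-κ * S.dj X) * Real.exp (-δ₀ * G.distD x X) *
          Real.exp (-δ₀ * G.distD y X) := by ring

/-- **The two-sided kernel bound from the FULL n = 2 form of (4.3)**: 𝐄^{(2)}(X, x, y) = Re ∂²_{τ₁τ₂}E_X(τ₁h_X(x) +
τ₂h_X(y))∣₀ + Re ∂_τE_X(τh⁽²⁾_X(x, y))∣₀ (`hrepr`; the r = 2 and r = 1 terms), E_X analytic on (4.4) with (1.18), the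
p. 282 bounds ‖h_X(x)‖ ≤ B₃e^{−δ₀dist(x,X)} (n(p) = 1) and ‖h⁽²⁾_X(x, y)‖ ≤ B₃′e^{−δ₀dist(x,X)}e^{−δ₀dist(y,X)} (n(p) = 2)
⇒ `KernelBound` with C_E = 4E₀α₂⁻²B₃² + E₀α₂⁻¹B₃′. [cite: Balaban1987RG1, (4.3)-(4.5) pp.281-282 and (4.35) p.290] -/
theorem kernelBound_of_repr43 (G : SiteGeometry C Λ) (EX : S.Dom → W → ℂ) (h : S.Dom → Λ → W)
    (h2 : S.Dom → Λ → Λ → W) (E2 : S.Dom → Λ → Λ → ℝ) {α₂ E₀ B₃ B₃' κ δ₀ : ℝ} (hα₂ : 0 < α₂) (hE₀ : 0 ≤ E₀)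
    (hB₃ : 0 ≤ B₃) (han : ∀ X, AnalyticOnNhd ℂ (EX X) (ball 0 α₂))
    (h118 : ∀ X, ∀ v ∈ ball (0 : W) α₂, ‖EX X v‖ ≤ E₀ * Real.exp (-κ * S.dj X))
    (hrepr : ∀ X x y, E2 X x y =
      (mixedDeriv (EX X) (h X x) (h X y)).re + (firstDeriv (EX X) (h2 X x y)).re)
    (hh : ∀ X x, ‖h X x‖ ≤ B₃ * Real.exp (-δ₀ * G.distD x X))
    (hh2 : ∀ X x y, ‖h2 X x y‖ ≤ B₃' * Real.exp (-δ₀ * G.distD x X) * Real.exp (-δ₀ * G.distD y X)) :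
    KernelBound G E2 (4 * E₀ / α₂ ^ 2 * B₃ ^ 2 + E₀ / α₂ * B₃') κ δ₀ := by
  have k2 : KernelBound G (fun X x y => (mixedDeriv (EX X) (h X x) (h X y)).re) (4 * E₀ / α₂ ^ 2 * B₃ ^ 2) κ δ₀ :=
    kernelBound_of_repr435 G (V := fun _ => W) (fun X a b => (mixedDeriv (EX X) a b).re) h
      (fun X x y => (mixedDeriv (EX X) (h X x) (h X y)).re) (A := 4 * E₀ / α₂ ^ 2) (by positivity) hB₃
      (fun _ _ _ => rfl) (qBound_of_analytic EX hα₂ han h118) hh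
  have k1 := kernelBound_r1 G EX h2 hα₂ han h118 hh2
  have k := kernelBound_add G k2 k1
  intro X x y
  rw [hrepr]
  exact k X x y

/-- **(5.10) on one finite system with the r = 1 term KEPT**: the hypotheses of `B12Decay510.abs_twoPoint_le_of_analytic`
with the full n = 2 representation and the n(p) = 2 block bound ⇒ ∣Σ_X 𝐄^{(2)}(X, x, y)∣ ≤
(4E₀α₂⁻²B₃² + E₀α₂⁻¹B₃′) e^{δ₁Mc₁} K₀K₁ e^{−δ₁∣x − y∣} with THE SAME δ₁ = ½ min{δ₀, κM⁻¹} — only the O(1) of (5.10) moves.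
[cite: Balaban1987RG1, (5.10) p.293] -/
theorem abs_twoPoint_le_of_repr43 (G : SiteGeometry C Λ) {ρ : Λ → Λ → ℝ} (EX : S.Dom → W → ℂ)
    (h : S.Dom → Λ → W) (h2 : S.Dom → Λ → Λ → W) (E2 : S.Dom → Λ → Λ → ℝ)
    {α₂ E₀ B₃ B₃' κ δ₀ M c₁ K₀ K₁ : ℝ} (hα₂ : 0 < α₂) (hE₀ : 0 ≤ E₀) (hB₃ : 0 ≤ B₃) (hB₃' : 0 ≤ B₃')
    (hK₀ : 0 ≤ K₀) (hδ₀ : 0 ≤ δ₀) (hκ : 0 ≤ κ) (hM : 0 < M) (han : ∀ X, AnalyticOnNhd ℂ (EX X) (ball 0 α₂))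
    (h118 : ∀ X, ∀ v ∈ ball (0 : W) α₂, ‖EX X v‖ ≤ E₀ * Real.exp (-κ * S.dj X))
    (hrepr : ∀ X x y, E2 X x y =
      (mixedDeriv (EX X) (h X x) (h X y)).re + (firstDeriv (EX X) (h2 X x y)).re)
    (hh : ∀ X x, ‖h X x‖ ≤ B₃ * Real.exp (-δ₀ * G.distD x X))
    (hh2 : ∀ X x y, ‖h2 X x y‖ ≤ B₃' * Real.exp (-δ₀ * G.distD x X) * Real.exp (-δ₀ * G.distD y X))
    (hgeo : GeomLeaf G ρ M c₁) (hcube : CubeSumLeaf G (δ₀ / 2) K₁) (htree : TreeLeaf C (κ / 2) K₀) (x y : Λ) :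
    |∑ X, E2 X x y| ≤ (4 * E₀ / α₂ ^ 2 * B₃ ^ 2 + E₀ / α₂ * B₃') * Real.exp (delta1 δ₀ κ M * M * c₁) * K₀ * K₁ *
      Real.exp (-(delta1 δ₀ κ M) * ρ x y) :=
  abs_twoPoint_le_delta1 G (by positivity) hK₀ hδ₀ hκ hM
    (kernelBound_of_repr43 G EX h h2 E2 hα₂ hE₀ hB₃ han h118 hrepr hh hh2) hgeo hcube htree x y

/-- **The whole chain for `B12Sec2to5.Decay510` with the r = 1 term KEPT**: a family of finite systems as in
`B12Decay510.decay510_of_analytic_leaves`, each with the full n = 2 form of (4.3) and the n(p) = 2 block bound, all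
constants volume-uniform, window-isometric embeddings of ℤᵈ and the limit (5.1) ⇒
`Decay510 P ((4E₀α₂⁻²B₃² + E₀α₂⁻¹B₃′) e^{δ₁Mc₁} K₀K₁) δ₁`, δ₁ = ½ min{δ₀, κM⁻¹}. [cite: Balaban1987RG1, (5.10) p.293] -/
theorem decay510_of_repr43_leaves {d : ℕ} (Sn : ℕ → LocDomainSys) (Cn : (n : ℕ) → B12.CubeCover (Sn n))
    (Λn : ℕ → Type*) (Gn : (n : ℕ) → SiteGeometry (Cn n) (Λn n)) (ρn : (n : ℕ) → Λn n → Λn n → ℝ)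
    (Wn : ℕ → Type*) [∀ n, NormedAddCommGroup (Wn n)] [∀ n, NormedSpace ℂ (Wn n)]
    (EXn : (n : ℕ) → (Sn n).Dom → Wn n → ℂ) (hn : (n : ℕ) → (Sn n).Dom → Λn n → Wn n)
    (h2n : (n : ℕ) → (Sn n).Dom → Λn n → Λn n → Wn n) (E2n : (n : ℕ) → (Sn n).Dom → Λn n → Λn n → ℝ)
    (e : (n : ℕ) → (Fin d → ℤ) → Λn n) (P : (Fin d → ℤ) → ℝ) {α₂ E₀ B₃ B₃' κ δ₀ M c₁ K₀ K₁ : ℝ}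
    (hα₂ : 0 < α₂) (hE₀ : 0 ≤ E₀) (hB₃ : 0 ≤ B₃) (hB₃' : 0 ≤ B₃') (hK₀ : 0 ≤ K₀) (hδ₀ : 0 ≤ δ₀) (hκ : 0 ≤ κ)
    (hM : 0 < M) (han : ∀ n X, AnalyticOnNhd ℂ (EXn n X) (ball 0 α₂))
    (h118 : ∀ n X, ∀ v ∈ ball (0 : Wn n) α₂, ‖EXn n X v‖ ≤ E₀ * Real.exp (-κ * (Sn n).dj X))
    (hrepr : ∀ n X x y, E2n n X x y =
      (mixedDeriv (EXn n X) (hn n X x) (hn n X y)).re + (firstDeriv (EXn n X) (h2n n X x y)).re)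
    (hh : ∀ n X x, ‖hn n X x‖ ≤ B₃ * Real.exp (-δ₀ * (Gn n).distD x X))
    (hh2 : ∀ n X x y, ‖h2n n X x y‖ ≤
      B₃' * Real.exp (-δ₀ * (Gn n).distD x X) * Real.exp (-δ₀ * (Gn n).distD y X))
    (hgeo : ∀ n, GeomLeaf (Gn n) (ρn n) M c₁) (hcube : ∀ n, CubeSumLeaf (Gn n) (δ₀ / 2) K₁)
    (htree : ∀ n, TreeLeaf (Cn n) (κ / 2) K₀)
    (hρ : ∀ z, ∀ᶠ n in atTop, ρn n (e n 0) (e n z) = B12Sec2to5.l1 z)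
    (hlim : ∀ z, Tendsto (fun n => ∑ X, E2n n X (e n 0) (e n z)) atTop (𝓝 (P z))) :
    B12Sec2to5.Decay510 P ((4 * E₀ / α₂ ^ 2 * B₃ ^ 2 + E₀ / α₂ * B₃') * Real.exp (delta1 δ₀ κ M * M * c₁) *
      K₀ * K₁) (delta1 δ₀ κ M) :=
  decay510_of_family Λn ρn (fun n x y => ∑ X, E2n n X x y) e P
    (fun n x y => abs_twoPoint_le_of_repr43 (Gn n) (EXn n) (hn n) (h2n n) (E2n n) hα₂ hE₀ hB₃ hB₃' hK₀ hδ₀ hκ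
      hM (han n) (h118 n) (hrepr n) (hh n) (hh2 n) (hgeo n) (hcube n) (htree n) x y) hρ hlim

/-! ## 4. The two-factor form from the printed tree-graph decay -/

omit [NormedSpace ℂ W] in
/-- **p. 282, n(p) = 2: tree-graph decay ⇒ one factor per B_i at half rate.**  IF ‖h⁽²⁾_X(x, y)‖ ≤ B e^{−δ₀ℓ_X(x,y)},
ℓ_X(x, y) the length of a (shortest) tree graph with initial points x, y and final point in X (*"it has an exponential
decay in a length of this graph … of a shortest tree graph of this type"*), and such a graph is at least dist(x, X) and
at least dist(y, X) long (`hℓx`, `hℓy`: it joins x, resp. y, to a point of X), THEN ‖h⁽²⁾_X(x, y)‖ ≤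
B e^{−(δ₀/2)dist(x,X)} e^{−(δ₀/2)dist(y,X)} — the two-factor form used in `kernelBound_r1`, at rate δ₀/2.
[cite: Balaban1987RG1, p.282] -/
theorem twoFactor_of_treeDecay (G : SiteGeometry C Λ) (h2 : S.Dom → Λ → Λ → W) (ℓ : S.Dom → Λ → Λ → ℝ)
    {B δ₀ : ℝ} (hB : 0 ≤ B) (hδ₀ : 0 ≤ δ₀) (hℓx : ∀ X x y, G.distD x X ≤ ℓ X x y)
    (hℓy : ∀ X x y, G.distD y X ≤ ℓ X x y) (hdec : ∀ X x y, ‖h2 X x y‖ ≤ B * Real.exp (-δ₀ * ℓ X x y))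
    (X : S.Dom) (x y : Λ) :
    ‖h2 X x y‖ ≤ B * Real.exp (-(δ₀ / 2) * G.distD x X) * Real.exp (-(δ₀ / 2) * G.distD y X) := by
  have hsum : -δ₀ * ℓ X x y ≤ -(δ₀ / 2) * G.distD x X + -(δ₀ / 2) * G.distD y X := by
    nlinarith [hℓx X x y, hℓy X x y, hδ₀]
  calc ‖h2 X x y‖ ≤ B * Real.exp (-δ₀ * ℓ X x y) := hdec X x y
    _ ≤ B * Real.exp (-(δ₀ / 2) * G.distD x X + -(δ₀ / 2) * G.distD y X) :=
        mul_le_mul_of_nonneg_left (Real.exp_le_exp.mpr hsum) hB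
    _ = B * Real.exp (-(δ₀ / 2) * G.distD x X) * Real.exp (-(δ₀ / 2) * G.distD y X) := by
        rw [Real.exp_add]; ring

/-! ## 5. The vanishing mechanism: (4.14) for 𝐄^{(j)}(X, ·) ⇒ (4.35) ⇒ (5.10) as in `B12Decay510` -/

/-- **(4.14) ⇒ (4.35)**: under the 𝐇-form `fderiv ℂ (EX X) 0 = 0` of (4.14) for the analytic E_X, the full n = 2 form
of (4.3) (`hrepr`) IS the printed (4.35) form 𝐄^{(2)}(X, x, y) = Re ∂²_{τ₁τ₂}E_X(τ₁h_X(x) + τ₂h_X(y))∣₀ (the hypothesis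
`hrepr` of `B12Decay510.abs_twoPoint_le_of_analytic`). [cite: Balaban1987RG1, (4.14) p.284 and (4.35) p.290] -/
theorem repr435_of_repr43 (EX : S.Dom → W → ℂ) (h : S.Dom → Λ → W) (h2 : S.Dom → Λ → Λ → W)
    (E2 : S.Dom → Λ → Λ → ℝ) {α₂ : ℝ} (hα₂ : 0 < α₂) (han : ∀ X, AnalyticOnNhd ℂ (EX X) (ball 0 α₂))
    (h414 : ∀ X, fderiv ℂ (EX X) 0 = 0)
    (hrepr : ∀ X x y, E2 X x y =
      (mixedDeriv (EX X) (h X x) (h X y)).re + (firstDeriv (EX X) (h2 X x y)).re) :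
    ∀ X x y, E2 X x y = (mixedDeriv (EX X) (h X x) (h X y)).re := by
  intro X x y
  have hd : DifferentiableAt ℂ (EX X) 0 := (han X 0 (mem_ball_self hα₂)).differentiableAt
  rw [hrepr, firstDeriv_eq_zero_of_fderiv_eq_zero hd (h414 X), Complex.zero_re, add_zero]

/-- **(4.14) ⇒ (5.10) with the printed (4.35) constant**: the full n = 2 representation + the 𝐇-form of (4.14) + the
hypotheses of `B12Decay510.abs_twoPoint_le_of_analytic` ⇒ its conclusion ∣Σ_X 𝐄^{(2)}(X, x, y)∣ ≤
4E₀α₂⁻²B₃² e^{δ₁Mc₁} K₀K₁ e^{−δ₁∣x − y∣} (no n(p) = 2 block bound needed). [cite: Balaban1987RG1, (4.35) p.290 and (5.10) p.293] -/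
theorem abs_twoPoint_le_of_repr43_of_414 (G : SiteGeometry C Λ) {ρ : Λ → Λ → ℝ} (EX : S.Dom → W → ℂ)
    (h : S.Dom → Λ → W) (h2 : S.Dom → Λ → Λ → W) (E2 : S.Dom → Λ → Λ → ℝ)
    {α₂ E₀ B₃ κ δ₀ M c₁ K₀ K₁ : ℝ} (hα₂ : 0 < α₂) (hE₀ : 0 ≤ E₀) (hB₃ : 0 ≤ B₃) (hK₀ : 0 ≤ K₀) (hδ₀ : 0 ≤ δ₀)
    (hκ : 0 ≤ κ) (hM : 0 < M) (han : ∀ X, AnalyticOnNhd ℂ (EX X) (ball 0 α₂))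
    (h118 : ∀ X, ∀ v ∈ ball (0 : W) α₂, ‖EX X v‖ ≤ E₀ * Real.exp (-κ * S.dj X))
    (h414 : ∀ X, fderiv ℂ (EX X) 0 = 0)
    (hrepr : ∀ X x y, E2 X x y =
      (mixedDeriv (EX X) (h X x) (h X y)).re + (firstDeriv (EX X) (h2 X x y)).re)
    (hh : ∀ X x, ‖h X x‖ ≤ B₃ * Real.exp (-δ₀ * G.distD x X))
    (hgeo : GeomLeaf G ρ M c₁) (hcube : CubeSumLeaf G (δ₀ / 2) K₁) (htree : TreeLeaf C (κ / 2) K₀) (x y : Λ) :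
    |∑ X, E2 X x y| ≤ 4 * E₀ / α₂ ^ 2 * B₃ ^ 2 * Real.exp (delta1 δ₀ κ M * M * c₁) * K₀ * K₁ *
      Real.exp (-(delta1 δ₀ κ M) * ρ x y) :=
  abs_twoPoint_le_of_analytic G EX h E2 hα₂ hE₀ hB₃ hK₀ hδ₀ hκ hM han h118
    (repr435_of_repr43 EX h h2 E2 hα₂ han h414 hrepr) hh hgeo hcube htree x y

end Robust

/-! ## 6. The window model of `B12Decay510Window` with the r = 1 term kept -/

section Window

open Literature.MathematicalPhysics.QuantumFieldTheory.Balaban1983to89.B13ScaleTransfer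
open Literature.MathematicalPhysics.QuantumFieldTheory.Balaban1983to89.TreeLength
open Literature.MathematicalPhysics.QuantumFieldTheory.Balaban1983to89.TreeLengthCubeSystem
open Literature.MathematicalPhysics.QuantumFieldTheory.Balaban1983to89.B12TreeDecay
open Literature.MathematicalPhysics.QuantumFieldTheory.Balaban1983to89.B12Decay510Window
open Literature.MathematicalPhysics.QuantumFieldTheory.Balaban1983to89.B12Sec2to5 (l1 l1_nonneg)

variable {d : ℕ}

/-- **(5.10) = `B12Sec2to5.Decay510` for an exhausting family of windows, geometric leaves discharged, the r = 1 term
KEPT**: the hypotheses of `B12Decay510Window.decay510_window` with the full n = 2 form of (4.3) (`hrepr`) and the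
n(p) = 2 block bound in window form (`hh2`, dist(x, X) = ∣x − nearest point of X∣₁) ⇒
`Decay510 P ((4E₀α₂⁻²B₃² + E₀α₂⁻¹B₃′) e^{2dδ₁} K₀(4·2ᵈ, 2d) K₁(δ₀/2)) δ₁`, δ₁ = ½ min{δ₀, κ/d} — the same rate as
`decay510_window`, the O(1) enlarged by E₀α₂⁻¹B₃′. [cite: Balaban1987RG1, (5.10) p.293] -/
theorem decay510_window_r1 (hd : 0 < d) (B : ℕ → Finset (Pt d)) (Wn : ℕ → Type*)
    [∀ n, NormedAddCommGroup (Wn n)] [∀ n, NormedSpace ℂ (Wn n)]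
    (EXn : (n : ℕ) → Dom (B n) → Wn n → ℂ) (hn : (n : ℕ) → Dom (B n) → Pt d → Wn n)
    (h2n : (n : ℕ) → Dom (B n) → Pt d → Pt d → Wn n) (E2n : (n : ℕ) → Dom (B n) → Pt d → Pt d → ℝ)
    (P : Pt d → ℝ) {α₂ E₀ B₃ B₃' κ δ₀ : ℝ} (hα₂ : 0 < α₂) (hE₀ : 0 ≤ E₀) (hB₃ : 0 ≤ B₃) (hB₃' : 0 ≤ B₃')
    (hδ₀ : 0 < δ₀) (hκ : kappa₀ (4 * 2 ^ d) (2 * d) ≤ κ / 2)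
    (han : ∀ n X, AnalyticOnNhd ℂ (EXn n X) (ball 0 α₂))
    (h118 : ∀ n X, ∀ v ∈ ball (0 : Wn n) α₂, ‖EXn n X v‖ ≤ E₀ * Real.exp (-κ * treeLen X.1))
    (hrepr : ∀ n X x y, E2n n X x y =
      (mixedDeriv (EXn n X) (hn n X x) (hn n X y)).re + (firstDeriv (EXn n X) (h2n n X x y)).re)
    (hh : ∀ n X x, ‖hn n X x‖ ≤ B₃ * Real.exp (-δ₀ * l1 (x - nearest (B n) x X)))
    (hh2 : ∀ n X x y, ‖h2n n X x y‖ ≤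
      B₃' * Real.exp (-δ₀ * l1 (x - nearest (B n) x X)) * Real.exp (-δ₀ * l1 (y - nearest (B n) y X)))
    (hlim : ∀ z, Tendsto (fun n => ∑ X : Dom (B n), E2n n X 0 z) atTop (𝓝 (P z))) :
    B12Sec2to5.Decay510 P ((4 * E₀ / α₂ ^ 2 * B₃ ^ 2 + E₀ / α₂ * B₃') * Real.exp (delta1 δ₀ κ d * d * 2) *
      K₀ (4 * 2 ^ d) (2 * d) * K₁ d (δ₀ / 2)) (delta1 δ₀ κ d) := by
  have hκ0 : 0 ≤ κ := by
    have := kappa₀_nonneg (c₀ := 4 * 2 ^ d) (by positivity) (2 * d)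
    linarith
  have hdR : (0 : ℝ) < d := Nat.cast_pos.2 hd
  refine decay510_of_repr43_leaves (fun n => sys (B n)) (fun n => (cubeSys (B n)).toCubeCover) (fun _ => Pt d)
    (fun n => geom (B n)) (fun _ x y => l1 (x - y)) Wn EXn hn h2n E2n (fun _ z => z) P hα₂ hE₀ hB₃ hB₃'
    (K₀_pos _ _).le hδ₀.le hκ0 hdR han h118 hrepr hh hh2 (fun n => geomLeaf (B n))
    (fun n => cubeSumLeaf (B n) (half_pos hδ₀)) (fun n => treeLeaf (B n) hκ)
    (fun z => Eventually.of_forall fun n => ?_) hlim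
  show l1 (0 - z) = l1 z
  rw [zero_sub, l1_neg]

end Window

end Literature.MathematicalPhysics.QuantumFieldTheory.Balaban1983to89.B12Decay510R1
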